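import Mathlib
import HarnessLib
import Summits.NavierStokesRegularity.NavierStokesRegularity.Theorems.QuarterLogPincerTypeIQuantSubcubicExpZoomTypeIBoundC

/-!
# Crux `QuarterLogPincer.TypeIQuantSubcubicExp` (stmt-NavierStokesRegularity-24077), line `thin_cascade`:
  clause (2) of `ThinObject` for the zoom limit — uniform local energy up to the final time

Helper file (`--supports stmt-NavierStokesRegularity-24077 --as helper`, lead prover ns-tc-p1 g3) toward
the registered stub `stub_thinObjectExtraction` (S2, skeleton v5).  For the KNSS zoom limit `W` of cheap
cascades (`exists_typeIAncientMild_zoomLimit_of_cheapCascades`, `…ZoomLimit`):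

* `lintegral_sq_ball_zoom_le` — every zoom `w = ρ • stPull (ρ²) ρ T x₀ u` of a Tao frame with the
  Type-I rate and backward life `e^{2K}ρ² ≤ T`, `K ≥ 1`, has `∫_{B(c,1)} ‖w(t)‖² ≤ C(M)` for every centre
  `c` and every `t ∈ (−1, 0)` (the `A`-clause of the proved stub `UniformScaledEnergy` at the vertex
  `T + ρ²t` of the time-restricted frame, radius `ρ`);
* `uniformLocalEnergy_zoomLimit_of_cheapCascades` — **clause (2)**:
  `∃ E, ∀ x₀, ∀ t ∈ (−1,0), ∫_{B(x₀,1)} ‖W(t)‖² ≤ E` (Fatou along the pointwise convergent zooms).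

HONEST FRAMING: bookkeeping toward one registered stub of an open crux; nothing about Navier–Stokes
regularity is proved; no summit statement is proved by this file.
-/

noncomputable section

-- the summit-side namespace `Summit.NavierStokesRegularity.NavierStokesRegularity.…` (single-conjunct summit,
-- D-0017) repeats a component by design; the dupNamespace linter would flag every declaration.
set_option linter.dupNamespace false

namespace Summit.NavierStokesRegularity.NavierStokesRegularity.Theorems.ThinCascade

open MeasureTheory Set Function Metric Filter Topology
open scoped ENNReal NNReal
open Literature.Analysis Literature.Analysis.FluidPDE
open Summit.NavierStokesRegularity.NavierStokesRegularity.Cruxes.TypeIQuantSubcubicExp.ThinCascade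
  (TaoFrame CheapCascade SingularAt UniformScaledEnergy stub_uniformScaledEnergy)

/-- **Unit-ball energies of the zoom are bounded by `C(M)` up to the final time.**  For a Tao frame
with the Type-I rate (constant `M`), scale `ρ > 0`, backward life `e^{2K}ρ² ≤ T` with `1 ≤ K`, and the
constant `C` of `UniformScaledEnergy` for `M`: for every centre `c` and `t ∈ (−1, 0)`,
`∫_{B(c,1)} ‖w(t,y)‖² dy ≤ C`, `w = ρ • stPull (ρ²) ρ T x₀ u`. [folklore] -/
theorem lintegral_sq_ball_zoom_le {M C T τ ρ : ℝ} {K : ℕ} (x₀ : EuclideanSpace ℝ (Fin 3))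
    {u : ℝ → EuclideanSpace ℝ (Fin 3) → EuclideanSpace ℝ (Fin 3)} {p : ℝ → EuclideanSpace ℝ (Fin 3) → ℝ}
    (hC : ∀ (T τ : ℝ) (u : ℝ → EuclideanSpace ℝ (Fin 3) → EuclideanSpace ℝ (Fin 3))
      (p : ℝ → EuclideanSpace ℝ (Fin 3) → ℝ), TaoFrame T u p → 0 < τ →
      (∀ t ∈ Icc 0 T, ∀ x : EuclideanSpace ℝ (Fin 3), ‖u t x‖ ≤ M * (T + τ - t) ^ (-(1 / 2 : ℝ))) →
      ∀ (x : EuclideanSpace ℝ (Fin 3)) (r : ℝ), 0 < r → r ^ 2 ≤ T →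
        (∀ t ∈ Icc (T - r ^ 2) T,
          ∫⁻ y in ball x r, ENNReal.ofReal (‖u t y‖ ^ 2) ≤ ENNReal.ofReal (C * r)) ∧
        (∫⁻ t in Icc (T - r ^ 2) T, ∫⁻ y in ball x r,
          ENNReal.ofReal (‖fderiv ℝ (u t) y‖ ^ 2) ≤ ENNReal.ofReal (C * r)) ∧
        (∫⁻ t in Icc (T - r ^ 2) T, ∫⁻ y in ball x r,
          ENNReal.ofReal (|p t y - ⨍ z in ball x r, p t z| ^ (3 / 2 : ℝ)) ≤ ENNReal.ofReal (C * r ^ 2)))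
    (hfr : TaoFrame T u p) (hτ : 0 < τ) (hρ : 0 < ρ) (hlife : Real.exp (2 * K) * ρ ^ 2 ≤ T) (hK : 1 ≤ K)
    (hrate : ∀ t ∈ Icc 0 T, ∀ x : EuclideanSpace ℝ (Fin 3), ‖u t x‖ ≤ M * (T + τ - t) ^ (-(1 / 2 : ℝ)))
    (c : EuclideanSpace ℝ (Fin 3)) {t : ℝ} (ht : t ∈ Ioo (-1 : ℝ) 0) :
    ∫⁻ y in ball c 1, ‖(ρ • stPull (ρ ^ 2) ρ T x₀ u) t y‖ₑ ^ 2 ≤ ENNReal.ofReal C := by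
  have hρ2 : 0 < ρ ^ 2 := by positivity
  -- `e^{2K} ≥ 2`
  have hexp : (2 : ℝ) ≤ Real.exp (2 * K) := by
    have h1 : (2 : ℝ) ≤ 2 * K := by
      have : (1 : ℝ) ≤ K := by exact_mod_cast hK
      linarith
    calc (2 : ℝ) ≤ 2 * K := h1
      _ ≤ 2 * K + 1 := by linarith
      _ ≤ Real.exp (2 * K) := Real.add_one_le_exp _
  -- the original vertex `t⋆ = T + ρ²t`
  set tstar : ℝ := T + ρ ^ 2 * t with htstar
  have hRt : ρ ^ 2 ≤ tstar := by
    have h2 : 2 * ρ ^ 2 ≤ T := le_trans (by nlinarith) hlife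
    rw [htstar]; nlinarith [ht.1]
  have htpos : 0 < tstar := lt_of_lt_of_le hρ2 hRt
  have htle : tstar ≤ T := by rw [htstar]; nlinarith [ht.2]
  have hfr' : TaoFrame tstar u p := frame_restrict hfr htpos htle
  have hrate' := typeI_restrict hrate htle
  have hτ' : 0 < T - tstar + τ := by linarith
  obtain ⟨hA, -, -⟩ := hC tstar (T - tstar + τ) u p hfr' hτ' hrate' (x₀ + ρ • c) ρ hρ hRt
  have h1 := hA tstar ⟨by linarith, le_rfl⟩
  rw [lintegral_sq_ball_zoom hρ T x₀ u t c 1, mul_one]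
  have h2 : ∫⁻ x in ball (x₀ + ρ • c) ρ, ‖u (T + ρ ^ 2 * t) x‖ₑ ^ 2 ≤ ENNReal.ofReal (C * ρ) := by
    refine le_trans (le_of_eq (lintegral_congr fun x => ?_)) h1
    rw [← ofReal_norm, ENNReal.ofReal_pow (norm_nonneg _)]
  calc (ENNReal.ofReal ρ)⁻¹ * ∫⁻ x in ball (x₀ + ρ • c) ρ, ‖u (T + ρ ^ 2 * t) x‖ₑ ^ 2
      ≤ (ENNReal.ofReal ρ)⁻¹ * ENNReal.ofReal (C * ρ) := mul_le_mul' le_rfl h2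
    _ = ENNReal.ofReal C := by
        rw [← ENNReal.ofReal_inv_of_pos hρ, ← ENNReal.ofReal_mul (by positivity)]
        congr 1
        field_simp

/-- **Clause (2) of `ThinObject` for the zoom limit of cheap cascades: uniform local energy up to the
final time.**  In the setting of `exists_typeIAncientMild_zoomLimit_of_cheapCascades`, the limit `W`
satisfies `∃ E, ∀ x₀, ∀ t ∈ (−1, 0), ∫_{B(x₀,1)} ‖W(t)‖² ≤ E` (Fatou along the zooms, which converge
pointwise on the open past and obey `lintegral_sq_ball_zoom_le`). [folklore] -/
theorem uniformLocalEnergy_zoomLimit_of_cheapCascades {M q : ℝ} {T τ ρ : ℕ → ℝ}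
    {x₀ : ℕ → EuclideanSpace ℝ (Fin 3)}
    {u : ℕ → ℝ → EuclideanSpace ℝ (Fin 3) → EuclideanSpace ℝ (Fin 3)}
    {p : ℕ → ℝ → EuclideanSpace ℝ (Fin 3) → ℝ}
    (hdata : ∀ K : ℕ, TaoFrame (T K) (u K) (p K) ∧ 0 < τ K ∧ 0 < ρ K ∧
        Real.exp (2 * K) * ρ K ^ 2 ≤ T K ∧
        τ K ≤ M ^ 2 * Real.exp (-2 * (K : ℝ)) * ρ K ^ 2 ∧
        (∀ t ∈ Icc 0 (T K), ∀ x : EuclideanSpace ℝ (Fin 3),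
          ‖u K t x‖ ≤ M * (T K + τ K - t) ^ (-(1 / 2 : ℝ))) ∧
        Real.exp K ≤ ρ K * ‖u K (T K) (x₀ K)‖ ∧
        ∀ j : ℕ, 1 ≤ j → j ≤ K →
          ∫⁻ x in {x : EuclideanSpace ℝ (Fin 3) | ρ K < ‖x - x₀ K‖ ∧ ‖x - x₀ K‖ < Real.exp j * ρ K},
              ENNReal.ofReal (‖u K (T K) x‖ ^ 3) ≤ ENNReal.ofReal (q * j))
    {φ : ℕ → ℕ} (hφ : StrictMono φ) {W : ℝ → EuclideanSpace ℝ (Fin 3) → EuclideanSpace ℝ (Fin 3)}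
    (hpt : ∀ t < 0, ∀ x, Tendsto
      (fun j => ((ρ (φ j)) • stPull (ρ (φ j) ^ 2) (ρ (φ j)) (T (φ j)) (x₀ (φ j)) (u (φ j))) t x)
      atTop (𝓝 (W t x))) :
    ∃ E : ℝ, ∀ c : EuclideanSpace ℝ (Fin 3), ∀ t ∈ Ioo (-1 : ℝ) 0,
      ∫⁻ y in ball c 1, ENNReal.ofReal (‖W t y‖ ^ 2) ≤ ENNReal.ofReal E := by
  obtain ⟨C, hC⟩ := stub_uniformScaledEnergy M
  refine ⟨C, fun c t ht => ?_⟩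
  set v : ℕ → ℝ → EuclideanSpace ℝ (Fin 3) → EuclideanSpace ℝ (Fin 3) :=
    fun j => (ρ (φ j)) • stPull (ρ (φ j) ^ 2) (ρ (φ j)) (T (φ j)) (x₀ (φ j)) (u (φ j)) with hv
  -- the zooms' unit-ball energies at time `t` are `≤ C` for `j ≥ 1` (`φ j ≥ 1`)
  have hbound : ∀ j, 1 ≤ j → ∫⁻ y in ball c 1, ‖v j t y‖ₑ ^ 2 ≤ ENNReal.ofReal C := by
    intro j hj
    have hK : 1 ≤ φ j := hj.trans (hφ.id_le j)
    exact lintegral_sq_ball_zoom_le (x₀ (φ j)) hC (hdata (φ j)).1 (hdata (φ j)).2.1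
      (hdata (φ j)).2.2.1 (hdata (φ j)).2.2.2.1 hK (hdata (φ j)).2.2.2.2.2.1 c ht
  -- measurability of the slices (the zooms are continuous on the open past)
  have hmeas : ∀ j, AEMeasurable (fun y => ‖v j t y‖ₑ ^ 2) (volume.restrict (ball c 1)) := by
    intro j
    have hz := zoom_of_cheapCascade (K := φ j) (x₀ (φ j)) (hdata (φ j)).1 (hdata (φ j)).2.1
      (hdata (φ j)).2.2.1 (hdata (φ j)).2.2.2.1 (hdata (φ j)).2.2.2.2.2.1
    have hslab : t ∈ Ioo (-Real.exp (2 * (φ j : ℕ))) 0 := by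
      refine ⟨?_, ht.2⟩
      have : (1 : ℝ) ≤ Real.exp (2 * (φ j : ℕ)) := Real.one_le_exp (by positivity)
      linarith [ht.1]
    have hcont : Continuous (v j t) := by
      have h1 : ContinuousOn (uncurry (v j)) (Ioo (-Real.exp (2 * (φ j : ℕ))) 0 ×ˢ univ) := hz.1
      have h2 : Continuous fun y : EuclideanSpace ℝ (Fin 3) => ((t, y) : ℝ × EuclideanSpace ℝ (Fin 3)) :=
        continuous_const.prodMk continuous_id
      exact h1.comp_continuous h2 fun y => ⟨hslab, mem_univ _⟩
    exact (hcont.aemeasurable.enorm.pow_const _).restrict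
  -- Fatou
  have hlim : ∀ y, Tendsto (fun j => ‖v j t y‖ₑ ^ 2) atTop (𝓝 (‖W t y‖ₑ ^ 2)) := fun y =>
    (ENNReal.continuous_pow 2 |>.tendsto _).comp ((continuous_enorm.tendsto _).comp (hpt t ht.2 y))
  calc ∫⁻ y in ball c 1, ENNReal.ofReal (‖W t y‖ ^ 2)
      = ∫⁻ y in ball c 1, ‖W t y‖ₑ ^ 2 := by
        refine lintegral_congr fun y => ?_
        rw [ENNReal.ofReal_pow (norm_nonneg _), ofReal_norm]
    _ = ∫⁻ y in ball c 1, liminf (fun j => ‖v j t y‖ₑ ^ 2) atTop :=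
        lintegral_congr fun y => ((hlim y).liminf_eq).symm
    _ ≤ liminf (fun j => ∫⁻ y in ball c 1, ‖v j t y‖ₑ ^ 2) atTop := lintegral_liminf_le' hmeas
    _ ≤ ENNReal.ofReal C :=
        liminf_le_of_le (h := fun b hb => by
          obtain ⟨j, hj⟩ := (hb.and (eventually_ge_atTop 1)).exists
          exact hj.1.trans (hbound j hj.2))

end Summit.NavierStokesRegularity.NavierStokesRegularity.Theorems.ThinCascade

end
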